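import Summits.BirchSwinnertonDyer.Rank1Residual.Iwasawa.LocalTowerKernelNumericTest
import Summits.BirchSwinnertonDyer.Rank1Residual.Iwasawa.LocalTowerKernelAtPGoodOrdinary
import HarnessLib

/-!
# `X(E/ℚ_∞) = 0` from CENSUS NUMERICS at a good ordinary non-anomalous `p`: `#Sel_{p^∞}(E/ℚ) = 1`,
# `p ∤ Δ_E · a_p · #Ẽ(𝔽_p)`, and at each bad `ℓ` either additive reduction (`p ≥ 5`) or
# `p ∤ c_ℓ · #Ẽ_ns(𝔽_ℓ)` (team n1011, rows T-T3CTL + T-GR34NA, seat p06 GEN 8, FILE 3 — the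
# ℚ-shaped composition; the `hBCS`/`hGr`-free trivial-partner road of X9 / X10b / T3-LIT)

HONEST FRAMING (cell `b2b-bsdres-*`, team n1011, verbatim): prove what is provable now; shrink each
hard class to its core with data; no claim beyond stated classes. Research route; TOOL theorems
only — no definition, no named fact, nothing booked, no residual-map mark moved, no class closed.

## What

Composition, no new idea: Greenberg's Prop. 3.8 at level `0` (T-T3CTL F1
`Iwasawa/SelmerInftyTrivialOfLevelZero`: `#Sel = 1` and all `𝒦_{v,0}[p^∞] = ⊥` ⟹ `X = 0`) with
its sockets discharged NUMERICALLY — `v ∣ p` by T-GR34NA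
(`GoodOrdinary.localTowerKerPrimary_zero_eq_bot_of_goodOrdinary_nonAnomalous`: good ordinary
non-anomalous, `κ` cyclotomic), additive `ℓ ≠ p` by F2b (`p ≥ 5`), the other bad `ℓ` by F2c
(`p ∤ c_ℓ · N_ℓ`):

* `subsingleton_X_of_card_selmer_eq_one_of_goodOrdinary_nonAnomalous` (`p ≥ 5`, additive places
  allowed) and `…_numeric` (any `p`, every bad place by the numeric test — the shape for `p = 3`
  partners with multiplicative bad primes): `Subsingleton D.X` for every dual datum over the
  cyclotomic `κ`;
* `isTorsion_and_mu_eq_zero_of_card_selmer_eq_one_of_goodOrdinary_nonAnomalous[_numeric]`: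
  `D.IsTorsion ∧ D.mu = 0 ∧ char = (g)` with `g` of unit content;
* `mu_anchor_of_card_selmer_eq_one_of_goodOrdinary_nonAnomalous[_numeric]`: the binder shape
  `∀ κ γ, κ.IsCyclotomic → κ.IsTopGenerator γ → IsCyclotomicVariable p γ → ∀ D₁, D₁.IsTorsion → D₁.mu = 0`
  (`hμ₁` of p07's T-E346-TP §A / `hmuA` of x9's U2) from census numerics ONLY.

This is the partner side `μ(E₁) = 0` (indeed `X(E₁/ℚ_∞) = 0`) of Greenberg–Vatsal WITHOUT the named
facts `hBCS` (BCS 2025, 1.1.2 (a)) and `hGr` (Greenberg 1999, Thm. 4.1) of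
`X9TrivialPartner.mazurMainConjecture_with_mu_zero_of_trivialArithmetic`, for partners whose data
pass the tests. It closes no class by itself; per-curve instances are the consumers'. Axioms standard.

References: [GreenbergLNM1716] §3 Prop. 3.8 and Remark (pp. 95–96), Lemma 3.4 (p. 89);
[GreenbergVatsal2000]; cells/n1011/skel/T-T3CTL.md, skel/T-GR34NA.md.
-/

noncomputable section

open scoped Classical

namespace Summit.BirchSwinnertonDyer.Rank1Residual.Iwasawa

open Literature.NumberTheory.EllipticCurves NumberField IsDedekindDomain Field WeierstrassCurve
  Rat.HeightOneSpectrum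

variable (W : WeierstrassCurve ℚ) [W.IsElliptic] [W.IsGloballyMinimal] {p : ℕ} [Fact p.Prime]

/-- **`X(E/ℚ_∞) = 0` from census numerics, `p ≥ 5`, additive bad places allowed.** For `E = W/ℚ`
elliptic and globally minimal, the cyclotomic `ℤ_p`-extension `κ` with topological generator `γ`,
any dual datum `D`: if `#Sel_{p^∞}(E/ℚ) = 1`; `S` is a finite set of places outside which `E` is
good away from `p`; at each `v ∈ S` above `p`: `p ∤ Δ_E`, `p ∤ a_p`, `p ∤ #Ẽ(𝔽_p)` (good ordinary
non-anomalous); at each `v ∈ S` not above `p`: additive reduction or the test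
`p ∤ c_ℓ · #Ẽ_ns(𝔽_ℓ)` — then `X = 0`. [cite: GreenbergLNM1716, §3 Prop. 3.8 (p. 95) and Lemma 3.4 (p. 89)] -/
theorem subsingleton_X_of_card_selmer_eq_one_of_goodOrdinary_nonAnomalous (hp5 : 5 ≤ p)
    {κ : ZpExtension ℚ p} {γ : Field.absoluteGaloisGroup ℚ} (hκ : κ.IsCyclotomic)
    (D : W.SelmerDualData κ γ) (hγ : κ.IsTopGenerator γ) (hSel : Nat.card (W.selmerGroupPInfty p) = 1)
    (S : Finset (HeightOneSpectrum (𝓞 ℚ)))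
    (hS : ∀ v ∈ S, (p : 𝓞 ℚ) ∉ v.asIdeal → W.HasAdditiveReductionAt v ∨
      ((primesEquiv v : ℕ) ≠ p ∧ ¬ p ∣ (W.baseChange (v.adicCompletion ℚ)).localTamagawaNumber
        (v.adicCompletionIntegers ℚ) * reductionPointCount W (primesEquiv v : ℕ)))
    (hΔ : ¬ (p : ℤ) ∣ minimalDiscriminantInt W) (hord : ¬ (p : ℤ) ∣ W.frobeniusTrace p)
    (hna : ¬ p ∣ W.reductionPointCount p)
    (hgood : ∀ v ∉ S, (p : 𝓞 ℚ) ∉ v.asIdeal ∧ W.HasGoodReductionAt v) :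
    Subsingleton D.X :=
  subsingleton_X_of_card_selmer_eq_one_of_numeric W hp5 D hγ hSel S hS
    (fun _ _ hpv ↦ GoodOrdinary.localTowerKerPrimary_zero_eq_bot_of_goodOrdinary_nonAnomalous W p
      hpv hΔ hord hna κ hκ) hgood

/-- **`X(E/ℚ_∞) = 0` from census numerics, any `p`, every bad place by the numeric test** (the shape
for `p = 3` partners with multiplicative bad primes): as above with, at each `v ∈ S` not above `p`,
`primesEquiv v ≠ p` and `p ∤ c_ℓ · #Ẽ_ns(𝔽_ℓ)`. [cite: GreenbergLNM1716, §3 Prop. 3.8 (p. 95) and Lemma 3.4 (p. 89)] -/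
theorem subsingleton_X_of_card_selmer_eq_one_of_goodOrdinary_nonAnomalous_numeric
    {κ : ZpExtension ℚ p} {γ : Field.absoluteGaloisGroup ℚ} (hκ : κ.IsCyclotomic)
    (D : W.SelmerDualData κ γ) (hγ : κ.IsTopGenerator γ) (hSel : Nat.card (W.selmerGroupPInfty p) = 1)
    (S : Finset (HeightOneSpectrum (𝓞 ℚ)))
    (hS : ∀ v ∈ S, (p : 𝓞 ℚ) ∉ v.asIdeal →
      (primesEquiv v : ℕ) ≠ p ∧ ¬ p ∣ (W.baseChange (v.adicCompletion ℚ)).localTamagawaNumber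
        (v.adicCompletionIntegers ℚ) * reductionPointCount W (primesEquiv v : ℕ))
    (hΔ : ¬ (p : ℤ) ∣ minimalDiscriminantInt W) (hord : ¬ (p : ℤ) ∣ W.frobeniusTrace p)
    (hna : ¬ p ∣ W.reductionPointCount p)
    (hgood : ∀ v ∉ S, (p : 𝓞 ℚ) ∉ v.asIdeal ∧ W.HasGoodReductionAt v) :
    Subsingleton D.X := by
  refine subsingleton_X_of_card_selmer_eq_one_of_finset D hγ hSel S (fun v hv ↦ ?_) hgood
  by_cases hpv : (p : 𝓞 ℚ) ∈ v.asIdeal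
  · exact GoodOrdinary.localTowerKerPrimary_zero_eq_bot_of_goodOrdinary_nonAnomalous W p hpv hΔ
      hord hna κ hκ
  · obtain ⟨hne, hnum⟩ := hS v hv hpv
    haveI : Fact (Nat.Prime (primesEquiv v : ℕ)) := ⟨(primesEquiv v).2⟩
    exact localTowerKerPrimary_zero_eq_bot_of_not_dvd W κ v (primesEquiv v : ℕ) rfl hne hpv hnum

/-- **`Λ`-torsion, `μ = 0`, `char = (g)` with `g` of unit content, from census numerics** (`p ≥ 5`,
additive bad places allowed). [cite: GreenbergLNM1716, §3 Prop. 3.8 (p. 95) and Lemma 3.4 (p. 89)] -/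
theorem isTorsion_and_mu_eq_zero_of_card_selmer_eq_one_of_goodOrdinary_nonAnomalous (hp5 : 5 ≤ p)
    {κ : ZpExtension ℚ p} {γ : Field.absoluteGaloisGroup ℚ} (hκ : κ.IsCyclotomic)
    (D : W.SelmerDualData κ γ) (hγ : κ.IsTopGenerator γ) (hSel : Nat.card (W.selmerGroupPInfty p) = 1)
    (S : Finset (HeightOneSpectrum (𝓞 ℚ)))
    (hS : ∀ v ∈ S, (p : 𝓞 ℚ) ∉ v.asIdeal → W.HasAdditiveReductionAt v ∨
      ((primesEquiv v : ℕ) ≠ p ∧ ¬ p ∣ (W.baseChange (v.adicCompletion ℚ)).localTamagawaNumber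
        (v.adicCompletionIntegers ℚ) * reductionPointCount W (primesEquiv v : ℕ)))
    (hΔ : ¬ (p : ℤ) ∣ minimalDiscriminantInt W) (hord : ¬ (p : ℤ) ∣ W.frobeniusTrace p)
    (hna : ¬ p ∣ W.reductionPointCount p)
    (hgood : ∀ v ∉ S, (p : 𝓞 ℚ) ∉ v.asIdeal ∧ W.HasGoodReductionAt v) :
    D.IsTorsion ∧ D.mu = 0 ∧
      ∃ g : PowerSeries ℤ_[p], D.charIdeal = Ideal.span {g} ∧ GreenbergVatsal2000.HasUnitContent g := by
  haveI := subsingleton_X_of_card_selmer_eq_one_of_goodOrdinary_nonAnomalous W hp5 hκ D hγ hSel S hS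
    hΔ hord hna hgood
  exact ⟨isTorsion_of_subsingleton D, mu_eq_zero_of_subsingleton D,
    exists_charIdeal_eq_span_hasUnitContent_of_subsingleton D⟩

/-- **`Λ`-torsion, `μ = 0`, `char = (g)` with `g` of unit content, from census numerics** (any `p`,
every bad place by the numeric test). [cite: GreenbergLNM1716, §3 Prop. 3.8 (p. 95) and Lemma 3.4 (p. 89)] -/
theorem isTorsion_and_mu_eq_zero_of_card_selmer_eq_one_of_goodOrdinary_nonAnomalous_numeric
    {κ : ZpExtension ℚ p} {γ : Field.absoluteGaloisGroup ℚ} (hκ : κ.IsCyclotomic)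
    (D : W.SelmerDualData κ γ) (hγ : κ.IsTopGenerator γ) (hSel : Nat.card (W.selmerGroupPInfty p) = 1)
    (S : Finset (HeightOneSpectrum (𝓞 ℚ)))
    (hS : ∀ v ∈ S, (p : 𝓞 ℚ) ∉ v.asIdeal →
      (primesEquiv v : ℕ) ≠ p ∧ ¬ p ∣ (W.baseChange (v.adicCompletion ℚ)).localTamagawaNumber
        (v.adicCompletionIntegers ℚ) * reductionPointCount W (primesEquiv v : ℕ))
    (hΔ : ¬ (p : ℤ) ∣ minimalDiscriminantInt W) (hord : ¬ (p : ℤ) ∣ W.frobeniusTrace p)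
    (hna : ¬ p ∣ W.reductionPointCount p)
    (hgood : ∀ v ∉ S, (p : 𝓞 ℚ) ∉ v.asIdeal ∧ W.HasGoodReductionAt v) :
    D.IsTorsion ∧ D.mu = 0 ∧
      ∃ g : PowerSeries ℤ_[p], D.charIdeal = Ideal.span {g} ∧ GreenbergVatsal2000.HasUnitContent g := by
  haveI := subsingleton_X_of_card_selmer_eq_one_of_goodOrdinary_nonAnomalous_numeric W hκ D hγ hSel S
    hS hΔ hord hna hgood
  exact ⟨isTorsion_of_subsingleton D, mu_eq_zero_of_subsingleton D,
    exists_charIdeal_eq_span_hasUnitContent_of_subsingleton D⟩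

/-- **The `μ`-anchor binder (`hμ₁` of T-E346-TP §A, `hmuA` of x9's U2) from census numerics ONLY**
(`p ≥ 5`, additive bad places allowed): for every cyclotomic `κ`, generator `γ` and dual datum,
`μ = 0`. [cite: GreenbergLNM1716, §3 Prop. 3.8 (p. 95) and Lemma 3.4 (p. 89)] -/
theorem mu_anchor_of_card_selmer_eq_one_of_goodOrdinary_nonAnomalous (hp5 : 5 ≤ p)
    (hSel : Nat.card (W.selmerGroupPInfty p) = 1) (S : Finset (HeightOneSpectrum (𝓞 ℚ)))
    (hS : ∀ v ∈ S, (p : 𝓞 ℚ) ∉ v.asIdeal → W.HasAdditiveReductionAt v ∨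
      ((primesEquiv v : ℕ) ≠ p ∧ ¬ p ∣ (W.baseChange (v.adicCompletion ℚ)).localTamagawaNumber
        (v.adicCompletionIntegers ℚ) * reductionPointCount W (primesEquiv v : ℕ)))
    (hΔ : ¬ (p : ℤ) ∣ minimalDiscriminantInt W) (hord : ¬ (p : ℤ) ∣ W.frobeniusTrace p)
    (hna : ¬ p ∣ W.reductionPointCount p)
    (hgood : ∀ v ∉ S, (p : 𝓞 ℚ) ∉ v.asIdeal ∧ W.HasGoodReductionAt v) :
    ∀ (κ : ZpExtension ℚ p) (γ : Field.absoluteGaloisGroup ℚ),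
      κ.IsCyclotomic → κ.IsTopGenerator γ → IsCyclotomicVariable p γ →
      ∀ D₁ : W.SelmerDualData κ γ, D₁.IsTorsion → D₁.mu = 0 := by
  intro κ γ hκ hγ _ D₁ _
  haveI := subsingleton_X_of_card_selmer_eq_one_of_goodOrdinary_nonAnomalous W hp5 hκ D₁ hγ hSel S hS
    hΔ hord hna hgood
  exact mu_eq_zero_of_subsingleton D₁

/-- **The `μ`-anchor binder from census numerics ONLY** (any `p`, every bad place by the numeric
test). [cite: GreenbergLNM1716, §3 Prop. 3.8 (p. 95) and Lemma 3.4 (p. 89)] -/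
theorem mu_anchor_of_card_selmer_eq_one_of_goodOrdinary_nonAnomalous_numeric
    (hSel : Nat.card (W.selmerGroupPInfty p) = 1) (S : Finset (HeightOneSpectrum (𝓞 ℚ)))
    (hS : ∀ v ∈ S, (p : 𝓞 ℚ) ∉ v.asIdeal →
      (primesEquiv v : ℕ) ≠ p ∧ ¬ p ∣ (W.baseChange (v.adicCompletion ℚ)).localTamagawaNumber
        (v.adicCompletionIntegers ℚ) * reductionPointCount W (primesEquiv v : ℕ))
    (hΔ : ¬ (p : ℤ) ∣ minimalDiscriminantInt W) (hord : ¬ (p : ℤ) ∣ W.frobeniusTrace p)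
    (hna : ¬ p ∣ W.reductionPointCount p)
    (hgood : ∀ v ∉ S, (p : 𝓞 ℚ) ∉ v.asIdeal ∧ W.HasGoodReductionAt v) :
    ∀ (κ : ZpExtension ℚ p) (γ : Field.absoluteGaloisGroup ℚ),
      κ.IsCyclotomic → κ.IsTopGenerator γ → IsCyclotomicVariable p γ →
      ∀ D₁ : W.SelmerDualData κ γ, D₁.IsTorsion → D₁.mu = 0 := by
  intro κ γ hκ hγ _ D₁ _
  haveI := subsingleton_X_of_card_selmer_eq_one_of_goodOrdinary_nonAnomalous_numeric W hκ D₁ hγ hSel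
    S hS hΔ hord hna hgood
  exact mu_eq_zero_of_subsingleton D₁

end Summit.BirchSwinnertonDyer.Rank1Residual.Iwasawa
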